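import Literature.AnabelianGeometry.EtaleTheta.TemperedFrobenioidCor38Sub
import Literature.AnabelianGeometry.EtaleTheta.BiKummerOfModel
import Literature.AlgebraicGeometry.Frobenioids.EquivalenceTransport
import Literature.AlgebraicGeometry.Frobenioids.FSMFFNaturalEndomorphisms
import HarnessLib

/-!
# [EtTh] Cor. 3.8 proof row C38-L02a `PreservesPreSteps` (F-2809): the BASE of the image of a pre-step under ANY
# equivalence is FIBERWISE-SURJECTIVE — a kernel constraint on the bare universal closure, for ALL typed data

S. Mochizuki, *The étale theta function and its Frobenioid-theoretic manifestations*, Publ. RIMS **45** (2009)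
[EtTh], Cor. 3.8 proof, PDF p. 81 l. 2–3 ("by [Mzk17], Theorem 3.4, (ii) … it follows that `Ψ` preserves
pre-steps") [cite: MochizukiEtTh2009, Cor 3.8 p.81]; S. Mochizuki, *The geometry of Frobenioids I* (2008) [FrdI],
§0 p. 14 (fiberwise-surjective morphisms, FSM-morphisms, categories of FSM-type), pp. 17–18 (FSMI-morphisms, categories
of FSMFF-type: "no endomorphism of an object of a category of FSMFF-type is an FSMI-morphism"), Def. 1.2 (iii) p. 22
(pre-steps = linear base-isomorphisms), Thm. 5.2 (i) p. 100 (model Frobenioids) [cite: MochizukiFrdI2008, §0 p.14].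

abc-iut cell, block C / FACT-proving, seat abc-iut-w6-d057 (gen 2).  PROOF-ONLY companion (0 definitions) of
abc-iut-w5-d124's statements-first sub-DAG file `TemperedFrobenioidCor38Sub.lean`, row C38-L02a =
`Cor38Hyp.PreservesPreSteps` (FACT-LIST F-2809) — the one proof row of the Cor. 3.8 cluster whose bare universal
closure is undecided in the kernel after p447778 (F-2810 `¬∀`), p448239 (F-2812 `¬∀`), p455772 (F-2815 `¬∀`);
desk verdict TRUE ×3 (abc-iut-f-136 g3, f-137 g3, L1-t13 g7), necessity of `Cor38Hyp.fsmff` kernel-certified by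
abc-iut-f-032 g6 (p460886, `ConeTwist.preservesPreSteps_shape_false_without_fsmff`); decision lease abc-iut-f-032 g7.
This file is a HAND for that decision: it settles, for ALL typed data, how far the BASE half of the row is forced.

WHAT IS PROVED (no hypothesis beyond the typed interface unless named in the signature).
* (consumed BY NAME, abc-iut-L1 lineage: `IsFiberwiseSurjective.map_equivalence` (`EquivalenceTransport.lean`,
  p404677) — an equivalence of categories carries fiberwise-surjective arrows to fiberwise-surjective arrows; and
  `IsOfFSMFFType.isIso_of_isFSM_of_isEndomorphism` (`FSMFFNaturalEndomorphisms.lean`, p452624) — [FrdI] §0 p. 18: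
  in a category of FSMFF-type every FSM ENDOmorphism is an isomorphism.)
* **`ModelFrobenioid.isFiberwiseSurjective_of_isIso_baseMap`**: in the model Frobenioid of ANY data
  `(D, Φ, B, B → Φ^gp)` with `B` group-like, every linear base-isomorphism `φ = (1, f, Z, u)` — every PRE-STEP,
  whatever its zero divisor `Z`, whatever the pull-backs — is fiberwise-surjective: for
  `ψ = (d, g, Z_ψ, u_ψ) : (B_D, ρ) → (A'_D, β)` the square is `W = (B_D, ρ·c⁻¹)`, `δ_X = (1, id, c, 1)`,
  `δ_B = (d, g f⁻¹, Z_ψ·c^{d−1}, ((g f⁻¹)^*u)⁻¹·u_ψ)` with `c := (g f⁻¹)^* Z`.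
* **`ModelFrobenioid.isFiberwiseSurjective_baseMap`**: fiberwise-surjectivity DESCENDS along `Base : C → D` (lift
  `γ : Y → A_D` to the pull-back morphism `(1, γ, 0, 0) : (Y, γ^*β) → (A_D, β)` and project the square).
* Hence **`Cor38Hyp.isFiberwiseSurjective_baseMap_map_of_isPreStep`** (and `…_inverse_map_…`): for EVERY record
  `h : Cor38Hyp C₁ C₂` and every pre-step `φ` of `C₁`, `Base(Ψ φ)` is fiberwise-surjective in `D₂`.
* Conditional closers of the row: **`Cor38Hyp.preservesPreSteps_of_preservesLinear_of_isIso_of_isFiberwiseSurjective`**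
  (F-2809 ⟸ row F-2815 at `h` + "fiberwise-surjective ⇒ invertible" in `D₁`, `D₂`: points, groupoids,
  `SingleObj Aff⁺(ℤ)`, `SingleObj` of a free monoid on two generators), its point-base instance
  `Cor38Hyp.preservesPreSteps_of_preservesLinear_of_isDiscrete`, and — USING the FSMFF hypothesis of Cor. 3.8 —
  **`Cor38Hyp.preservesPreSteps_of_preservesLinear_of_subsingleton`** (one-object bases all of whose arrows are
  monomorphisms, e.g. `SingleObj` of any left-cancellative monoid of FSMFF-type).

READING (cell rule R5; FACT-LIST F-2809 label unchanged: conditional / instance PROVED / bare closure open-as-typed).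
What the kernel now says about a would-be separating model `Ψ`: it must send some pre-step EITHER to a non-linear
morphism (the F-2815 degree mechanism — which at the tree's degree-moving record `AffDil.hyp` does not happen,
abc-iut-w4-d097's `AffDil.preservesPreSteps_hyp`) OR to a morphism whose `Base` is a fiberwise-surjective
NON-isomorphism of `D₂` that is NOT a monic endomorphism — i.e. a non-monic arrow, or an FSM arrow between distinct
objects with a finite FSMI-factorisation.  In particular the free-monoid base `SingleObj (FreeMonoid (Fin 2))` (only
`1` fiberwise-surjective) cannot host a base-moving countermodel, and g6's `ConeTwist` translation `t` (FS, monic,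
an endomorphism) is excluded exactly by `isIso_of_isFSM_of_isEndomorphism`.  Instance forms of record are untouched
(`Cor38Hyp.preservesPreSteps_of_thm34ii`, abc-iut-f-001's `preservesPreSteps_treeCatVocab_of_isMonoidOn`).
HONEST FRAMING: bookkeeping about OUR typed interface ([EtTh] Cor. 3.8 itself quotes [FrdI] Thm. 3.4 (ii) for
genuine Frobenioids); nothing here bears on [IUTchIII] Cor. 3.12; no side taken; typed ≠ proved.
-/

namespace Literature.AlgebraicGeometry.Frobenioids

open CategoryTheory Opposite

universe w v u

/-! ## Model Frobenioids: pre-steps are fiberwise-surjective; fiberwise-surjectivity descends along `Base` -/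

namespace ModelFrobenioid

variable {D : Type u} [Category.{v} D] {Φ B : Dᵒᵖ ⥤ CommMonCat.{w}} {DivB : B ⟶ monoidGp Φ}

/-- **Fiberwise-surjectivity descends along `Base : C → D`**: lift `γ : Y → Base(Q)` to the pull-back morphism
`(1, γ, 0, 0) : (Y, γ^*β) → Q = (A_D, β)` and project a completing square. [cite: MochizukiFrdI2008, Thm. 5.2(i) p.100] -/
theorem isFiberwiseSurjective_baseMap {P Q : ModelFrobenioid Φ B DivB} (φ : P ⟶ Q)
    (h : IsFiberwiseSurjective φ) : IsFiberwiseSurjective (baseMap φ) := by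
  intro Y γ
  let R : ModelFrobenioid Φ B DivB := ⟨Y, pullGp Φ γ Q.cls⟩
  let ψ : R ⟶ Q :=
    { degFr := 1
      base := γ
      div := 1
      unit := 1
      rel := by rw [PNat.one_coe, pow_one, map_one, mul_one, map_one, mul_one] }
  obtain ⟨W, δB, δX, hsq⟩ := h ψ
  exact ⟨W.base, baseMap δB, baseMap δX, congrArg Hom.base hsq⟩

/-- The commutative-group bookkeeping behind the completing square of
`isFiberwiseSurjective_of_isIso_baseMap`. [folklore] -/
private theorem square_rel_aux {G : Type w} [CommGroup G] (r z c X u y : G) (n : ℕ)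
    (h : r ^ (n + 1) * z = X * c * u⁻¹ * y) : (r * c⁻¹) ^ (n + 1) * (z * c ^ n) = X * (u⁻¹ * y) := by
  calc (r * c⁻¹) ^ (n + 1) * (z * c ^ n) = r ^ (n + 1) * z * ((c⁻¹) ^ (n + 1) * c ^ n) := by
        rw [mul_pow, mul_mul_mul_comm]
    _ = X * c * u⁻¹ * y * c⁻¹ := by rw [h, inv_pow, pow_succ, mul_inv_rev, inv_mul_cancel_right]
    _ = X * (u⁻¹ * y) := by
        rw [mul_right_comm X c u⁻¹, mul_right_comm (X * u⁻¹) c y, mul_inv_cancel_right, mul_assoc]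

/-- **Every linear base-isomorphism — every PRE-STEP of a model Frobenioid with group-like `B`, whatever its zero
divisor — is fiberwise-surjective** ([FrdI] §0, Def. 1.2 (iii), Thm. 5.2 (i)).  The completing square for
`φ = (1, f, Z, u) : (A_D, α) → (A'_D, β)` and `ψ = (d, g, Z_ψ, u_ψ) : (B_D, ρ) → (A'_D, β)`:
`W = (B_D, ρ·c⁻¹)`, `δ_X = (1, id, c, 1) : W → (B_D, ρ)`, `δ_B = (d, g f⁻¹, Z_ψ·c^{d−1}, ũ⁻¹·u_ψ) : W → (A_D, α)`,
where `c := (g f⁻¹)^* Z` and `ũ := (g f⁻¹)^* u`. [cite: MochizukiFrdI2008, Def. 1.2 (iii) p.22] -/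
theorem isFiberwiseSurjective_of_isIso_baseMap (hB : ∀ (A : Dᵒᵖ) (b : (B.obj A : Type w)), IsUnit b)
    {P Q : ModelFrobenioid Φ B DivB} (φ : P ⟶ Q) (hd : degFr φ = 1) (hf : IsIso (baseMap φ)) :
    IsFiberwiseSurjective φ := by
  intro R γ
  haveI := hf
  -- the base arrow `g f⁻¹ : B_D → A_D`, the pulled-back divisor `c` and unit `ũ`
  let g' : R.base ⟶ P.base := baseMap γ ≫ inv (baseMap φ)
  have hg' : g' ≫ baseMap φ = baseMap γ := by
    change (baseMap γ ≫ inv (baseMap φ)) ≫ baseMap φ = baseMap γ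
    rw [Category.assoc, IsIso.inv_hom_id, Category.comp_id]
  let c : (Φ.obj (op R.base) : Type w) := (Φ.map g'.op).hom (div φ)
  obtain ⟨ut, hut⟩ := hB (op R.base) ((B.map g'.op).hom (unit φ))
  -- the pulled-back relation of `φ` and the relation of `γ`
  have hφ' := congrArg (pullGp Φ g') (rel φ)
  rw [hd, PNat.one_coe, pow_one, map_mul, map_mul, pullGp_of, ← pullGp_comp, pullGp_divB, hg', ← hut] at hφ'
  -- `hφ' : pullGp g' P.cls * of c = pullGp (baseMap γ) Q.cls * divB ↑ut`
  have hQ : pullGp Φ (baseMap γ) Q.cls = pullGp Φ g' P.cls * Algebra.GrothendieckGroup.of c *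
      (divB Φ B DivB (op R.base) (ut : (B.obj (op R.base) : Type w)))⁻¹ := by
    rw [eq_mul_inv_iff_mul_eq, hφ']
  have hγ := rel γ
  rw [hQ, ← PNat.natPred_add_one (degFr γ)] at hγ
  -- the completing square
  let W : ModelFrobenioid Φ B DivB := ⟨R.base, R.cls * (Algebra.GrothendieckGroup.of c)⁻¹⟩
  let δX : W ⟶ R :=
    { degFr := 1
      base := 𝟙 R.base
      div := c
      unit := 1
      rel := by
        change (R.cls * (Algebra.GrothendieckGroup.of c)⁻¹) ^ ((1 : ℕ+) : ℕ) * Algebra.GrothendieckGroup.of c =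
          pullGp Φ (𝟙 R.base) R.cls * divB Φ B DivB (op R.base) 1
        rw [PNat.one_coe, pow_one, inv_mul_cancel_right, pullGp_id, map_one, mul_one] }
  let δB : W ⟶ P :=
    { degFr := degFr γ
      base := g'
      div := div γ * c ^ (degFr γ).natPred
      unit := ↑ut⁻¹ * unit γ
      rel := by
        change (R.cls * (Algebra.GrothendieckGroup.of c)⁻¹) ^ (degFr γ : ℕ) *
            Algebra.GrothendieckGroup.of (div γ * c ^ (degFr γ).natPred) =
          pullGp Φ g' P.cls * divB Φ B DivB (op R.base) (↑ut⁻¹ * unit γ)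
        rw [← PNat.natPred_add_one (degFr γ), map_mul, map_pow, map_mul, map_units_inv]
        exact square_rel_aux _ _ _ _ _ _ _ hγ }
  refine ⟨W, δB, δX, hom_ext ?_ ?_ ?_ ?_⟩
  · change degFr φ * degFr γ = degFr γ * 1
    rw [hd, one_mul, mul_one]
  · change g' ≫ baseMap φ = 𝟙 R.base ≫ baseMap γ
    rw [hg', Category.id_comp]
  · change (Φ.map g'.op).hom (div φ) * (div γ * c ^ (degFr γ).natPred) ^ (degFr φ : ℕ) =
      (Φ.map (𝟙 R.base).op).hom (div γ) * c ^ (degFr γ : ℕ)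
    rw [hd, PNat.one_coe, pow_one, op_id, Φ.map_id, CommMonCat.hom_id, MonoidHom.id_apply, mul_left_comm,
      ← pow_succ', PNat.natPred_add_one]
  · change (B.map g'.op).hom (unit φ) * (↑ut⁻¹ * unit γ) ^ (degFr φ : ℕ) =
      (B.map (𝟙 R.base).op).hom (unit γ) * 1 ^ (degFr γ : ℕ)
    rw [hd, PNat.one_coe, pow_one, ← hut, ← mul_assoc, Units.mul_inv, one_mul, op_id, B.map_id,
      CommMonCat.hom_id, MonoidHom.id_apply, one_pow, mul_one]

end ModelFrobenioid

end Literature.AlgebraicGeometry.Frobenioids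

/-! ## The row C38-L02a over the typed Def. 3.6 interface -/

namespace Literature.AnabelianGeometry.EtaleTheta

open CategoryTheory Opposite Literature.AlgebraicGeometry.Frobenioids

universe u₀ v₀ u v w

variable {D₀ : Type u₀} [Category.{v₀} D₀] {V : FrdIMonoidStub.{w}}
  {T : RealifiedDivisorMonoids (D₀ := D₀) V} {D : Type u} [Category.{v} D] {VD : FrdICatStub.{u, v, w} D}

namespace TemperedFrobenioid

/-- **Every pre-step of the Frobenioid of a typed tempered Frobenioid is fiberwise-surjective** (`B = B₀^Λ ×
Φ^gp` is group-like by Def. 3.6 (i), `RealifiedDivisorMonoids.isUnit_BΛ`). [cite: MochizukiEtTh2009, Def 3.6 p.77] -/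
theorem isFiberwiseSurjective_of_isPreStep (C : TemperedFrobenioid T D VD) {X Y : C.category} (φ : X ⟶ Y)
    (hφ : C.opsData.IsPreStep φ) : IsFiberwiseSurjective φ :=
  ModelFrobenioid.isFiberwiseSurjective_of_isIso_baseMap (fun _ b => C.isUnit_ratFn (T.isUnit_BΛ _) b) φ
    hφ.1 hφ.2

end TemperedFrobenioid

section Rows

variable {D₀' : Type u₀} [Category.{v₀} D₀'] {T' : RealifiedDivisorMonoids (D₀ := D₀') V}
  {D' : Type u} [Category.{v} D'] {VD' : FrdICatStub.{u, v, w} D'}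
  {C₁ : TemperedFrobenioid T D VD} {C₂ : TemperedFrobenioid T' D' VD'}

namespace Cor38Hyp

variable (h : Cor38Hyp C₁ C₂)

/-- `Ψ` of a pre-step is fiberwise-surjective in `C₂`. [cite: MochizukiEtTh2009, Cor 3.8 p.81] -/
theorem isFiberwiseSurjective_map_of_isPreStep {X Y : C₁.category} (φ : X ⟶ Y)
    (hφ : C₁.opsData.IsPreStep φ) : IsFiberwiseSurjective (h.Ψ.functor.map φ) :=
  IsFiberwiseSurjective.map_equivalence h.Ψ (C₁.isFiberwiseSurjective_of_isPreStep φ hφ)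

/-- **Row C38-L02a / F-2809, BASE HALF up to fiberwise-surjectivity, for EVERY record**: for every
`h : Cor38Hyp C₁ C₂` and every pre-step `φ` of `C₁`, `Base(Ψ φ)` is a fiberwise-surjective arrow of `D₂`.
[cite: MochizukiEtTh2009, Cor 3.8 p.81] -/
theorem isFiberwiseSurjective_baseMap_map_of_isPreStep {X Y : C₁.category} (φ : X ⟶ Y)
    (hφ : C₁.opsData.IsPreStep φ) : IsFiberwiseSurjective (ModelFrobenioid.baseMap (h.Ψ.functor.map φ)) :=
  ModelFrobenioid.isFiberwiseSurjective_baseMap _ (h.isFiberwiseSurjective_map_of_isPreStep φ hφ)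

/-- The mirror for `Ψ⁻¹`: `Base(Ψ⁻¹ φ)` is fiberwise-surjective in `D₁` for every pre-step `φ` of `C₂`.
[cite: MochizukiEtTh2009, Cor 3.8 p.81] -/
theorem isFiberwiseSurjective_baseMap_inverse_map_of_isPreStep {X Y : C₂.category} (φ : X ⟶ Y)
    (hφ : C₂.opsData.IsPreStep φ) : IsFiberwiseSurjective (ModelFrobenioid.baseMap (h.Ψ.inverse.map φ)) :=
  ModelFrobenioid.isFiberwiseSurjective_baseMap _
    (IsFiberwiseSurjective.map_equivalence h.Ψ.symm (C₂.isFiberwiseSurjective_of_isPreStep φ hφ))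

/-- **Conditional closer of F-2809**: if `Ψ`, `Ψ⁻¹` preserve linear morphisms (row F-2815 at `h`) and in `D₁`, `D₂`
every fiberwise-surjective arrow is invertible (points, groupoids, `SingleObj Aff⁺(ℤ)`, `SingleObj` of a free monoid
on two generators, …), then `Ψ` preserves pre-steps. [cite: MochizukiEtTh2009, Cor 3.8 p.81] -/
theorem preservesPreSteps_of_preservesLinear_of_isIso_of_isFiberwiseSurjective (hL : h.PreservesLinear)
    (hD : ∀ ⦃a b : D⦄ (g : a ⟶ b), IsFiberwiseSurjective g → IsIso g)
    (hD' : ∀ ⦃a b : D'⦄ (g : a ⟶ b), IsFiberwiseSurjective g → IsIso g) : h.PreservesPreSteps :=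
  ⟨fun _ _ φ hφ => ⟨hL.1 φ hφ.1, hD' _ (h.isFiberwiseSurjective_baseMap_map_of_isPreStep φ hφ)⟩,
    fun _ _ φ hφ => ⟨hL.2 φ hφ.1, hD _ (h.isFiberwiseSurjective_baseMap_inverse_map_of_isPreStep φ hφ)⟩⟩

/-- Point-base instance (all the `Discrete PUnit`-based toys of the tree, and any discrete base): F-2809 ⟸ F-2815
at `h`. [cite: MochizukiEtTh2009, Cor 3.8 p.81] -/
theorem preservesPreSteps_of_preservesLinear_of_isDiscrete [IsDiscrete D] [IsDiscrete D']
    (hL : h.PreservesLinear) : h.PreservesPreSteps :=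
  h.preservesPreSteps_of_preservesLinear_of_isIso_of_isFiberwiseSurjective hL (fun _ _ _ _ => inferInstance)
    (fun _ _ _ _ => inferInstance)

/-- **Conditional closer of F-2809 USING `Cor38Hyp.fsmff`**: over one-object bases all of whose arrows are
monomorphisms (e.g. `SingleObj` of a left-cancellative monoid of FSMFF-type), `Base(Ψ φ)` of a pre-step is an FSM
endomorphism of a category of FSMFF-type, hence invertible (`IsOfFSMFFType.isIso_of_isFSM_of_isEndomorphism`); with row
F-2815 at `h`, `Ψ` preserves pre-steps. [cite: MochizukiEtTh2009, Cor 3.8 p.81] -/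
theorem preservesPreSteps_of_preservesLinear_of_subsingleton [Subsingleton D] [Subsingleton D']
    (hm : ∀ ⦃a b : D⦄ (g : a ⟶ b), Mono g) (hm' : ∀ ⦃a b : D'⦄ (g : a ⟶ b), Mono g)
    (hL : h.PreservesLinear) : h.PreservesPreSteps := by
  have hD : ∀ ⦃a b : D⦄ (g : a ⟶ b), IsFiberwiseSurjective g → IsIso g := by
    intro a b g hg
    obtain rfl : a = b := Subsingleton.elim a b
    exact h.fsmff.1.isIso_of_isFSM_of_isEndomorphism g ⟨hg, hm g⟩
  have hD' : ∀ ⦃a b : D'⦄ (g : a ⟶ b), IsFiberwiseSurjective g → IsIso g := by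
    intro a b g hg
    obtain rfl : a = b := Subsingleton.elim a b
    exact h.fsmff.2.isIso_of_isFSM_of_isEndomorphism g ⟨hg, hm' g⟩
  exact h.preservesPreSteps_of_preservesLinear_of_isIso_of_isFiberwiseSurjective hL hD hD'

end Cor38Hyp

end Rows

end Literature.AnabelianGeometry.EtaleTheta
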